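import Summits.NavierStokesRegularity.NavierStokesRegularity.Theorems.AdaptedFrequencyFrequencyRigidityCriticalStrainFloor
import Summits.NavierStokesRegularity.NavierStokesRegularity.Theorems.AdaptedFrequencyFrequencyRigidityFlatSelfSimilarLeaf
import Literature.Analysis.FluidPDE.CurlFreeLiouville
import Literature.Analysis.FluidPDE.LocalBiotSavartCalculus

/-!
# Crux `FrequencyRigidity` (stmt-NavierStokesRegularity-2955), line `two-ended-pinning`:
# Stub 3 — the palinstrophy of a flat inhabitant is positive; the critical-strain floor is STRICT

Helper file (`--supports stmt-NavierStokesRegularity-2955`; theorems only; lead c1), sequel to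
`AdaptedFrequencyFrequencyRigidityCriticalStrainFloor` (the floor `M ≥ 1/(−t)` for any bound
`⟪ω, Dv ω⟫ ≤ M‖ω‖²` on a flat inhabitant, from the instantaneous budget
`∫ 2(⟪ω, Dv ω⟫ − ν|∇ω|²_F) K(t) = 2A(−t)^{−3}`).  Here the dissipation term is brought back in:

* `curl_eq_zero_of_fderiv_curl_eq_zero` — a bounded, divergence-free, smooth field on `ℝ³` whose
  vorticity is spatially constant is irrotational (`curl ω = 0 ⇒ ΔV = −curl curl V = 0`, and a
  bounded harmonic field is constant — Liouville; KNSS 2009 Lemma 3.1 pattern).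
* `exists_frobeniusNormSq_fderiv_curl_pos_of_isFlatInhabitant` — hence a flat inhabitant's
  vorticity is NEVER spatially constant: at every `t < 0` there is a point with `|∇ω|²_F > 0`
  (else `curl v(t) ≡ 0` by the above and the Type-I bound, so `H(t) = 0 ≠ A(−t)^{−2}`).
* `palinstrophy_balance_of_isFlatInhabitant` — the budget with every term finite:
  `ν ∫ |∇ω|²_F K = ∫ ⟪ω, Dv ω⟫ K − A(−t)^{−3}` (stretching against the kernel exceeds the
  self-similar production rate `A(−t)^{−3}` by exactly the kernel-weighted palinstrophy);
* `integral_palinstrophy_pos_of_isFlatInhabitant` — and `∫ |∇ω|²_F K(t) > 0` at every `t < 0`;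
* **`stub_flatEnstrophyLiouville_strictStrainFloor`** (registered sub-goal of Stub 3) — so the
  floor is STRICT: `⟪ω, Dv ω⟫ ≤ M‖ω‖²` on `ℝ³` at some `t < 0` forces `M > 1/(−t)`; in particular
  `sup_x ‖Dv(t,x)‖ > 1/(−t)` is NOT attained by a uniform bound `1/(−t)` and `C'₁ > 1`
  (`one_lt_scaleInvariantConst_one_of_isFlatInhabitant`).  The disprover's linear strain near-miss
  (`Negative/LinearStrainFlow`: stretching exactly `1/(−t)`, `∇ω = 0`) sits exactly ON the
  excluded boundary.

## References

* G. Koch, N. Nadirashvili, G. Seregin, V. Šverák, Acta Math. 203 (2009) 83–105, Lemma 3.1. [KochNadirashviliSereginSverak2009]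
* T.-P. Tsai, Arch. Ration. Mech. Anal. 143 (1998) 29–51. [Tsai1998]
-/

noncomputable section

-- the summit-side namespace `Summit.NavierStokesRegularity.NavierStokesRegularity.…` repeats a component by design (D-0017)
set_option linter.dupNamespace false

namespace Summit.NavierStokesRegularity.NavierStokesRegularity.Theorems.FrequencyRigidity.TwoEndedPinning

open Literature.Analysis.FluidPDE MeasureTheory Set Filter Topology Function InnerProductSpace
open scoped RealInnerProductSpace Laplacian ContDiff
open Summit.NavierStokesRegularity.NavierStokesRegularity.Theorems.FrequencyRigidity.Negative.TwoEndedPinning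
  (IsFlatInhabitant firstVariationDensity ScaleInvariantBounds)

/-! ### Linear algebra: vanishing Frobenius norm -/

/-- A linear map on `ℝ³` with vanishing Frobenius norm is zero (every basis image vanishes). [folklore] -/
theorem eq_zero_of_frobeniusNormSq_eq_zero
    (L : EuclideanSpace ℝ (Fin 3) →L[ℝ] EuclideanSpace ℝ (Fin 3)) (h : frobeniusNormSq L = 0) :
    L = 0 := by
  set b := stdOrthonormalBasis ℝ (EuclideanSpace ℝ (Fin 3)) with hb
  have hsum : ∑ i, ‖L (b i)‖ ^ 2 = 0 := by simpa [frobeniusNormSq] using h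
  have hterm := (Finset.sum_eq_zero_iff_of_nonneg (fun i _ => sq_nonneg ‖L (b i)‖)).1 hsum
  have hLi : ∀ i, L (b i) = 0 := fun i => by
    have := hterm i (Finset.mem_univ i)
    rwa [sq_eq_zero_iff, norm_eq_zero] at this
  ext1 w
  rw [← b.sum_repr' w, map_sum]
  simp [map_smul, hLi]

/-! ### A bounded divergence-free field with constant vorticity is irrotational -/

/-- **Constant vorticity + incompressible + bounded ⇒ irrotational.**  If `V : ℝ³ → ℝ³` is
smooth, divergence-free and bounded, and `∇(curl V) ≡ 0`, then `curl V ≡ 0`: the vorticity is a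
constant `c`, so `curl (curl V) = 0` and `ΔV = −curl curl V = 0`
(`laplacian_eq_neg_curl_curl`); a bounded harmonic field is constant
(`isConst_of_harmonic_bounded_inner`), and constants are irrotational. [cite: KochNadirashviliSereginSverak2009, Lemma 3.1 (arXiv p. 7)] -/
theorem curl_eq_zero_of_fderiv_curl_eq_zero
    {V : EuclideanSpace ℝ (Fin 3) → EuclideanSpace ℝ (Fin 3)} (hV : ContDiff ℝ ∞ V)
    (hdiv : VectorCalculus.IsDivFree V) {M : ℝ} (hM : ∀ x, ‖V x‖ ≤ M)
    (h0 : ∀ x, fderiv ℝ (curl V) x = 0) (x : EuclideanSpace ℝ (Fin 3)) : curl V x = 0 := by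
  have hV2 : ContDiff ℝ 2 V := hV.of_le (by norm_cast)
  have hcurl1 : ContDiff ℝ 1 (curl V) := by
    rw [curl_eq_curlCLM_comp]
    exact curlCLM.contDiff.comp (hV2.fderiv_right (m := 1) (by norm_num))
  have hconst : ∀ y, curl V y = curl V 0 :=
    fun y => is_const_of_fderiv_eq_zero (hcurl1.differentiable one_ne_zero) h0 y 0
  have hcc : ∀ y, curl (curl V) y = 0 := fun y => by
    rw [show curl V = fun _ => curl V 0 from funext hconst]
    exact curl_fun_const _ _
  have hΔ : ∀ y, (Δ V) y = 0 := fun y => by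
    rw [laplacian_eq_neg_curl_curl hV2 hdiv y, hcc y, neg_zero]
  have hharm : HarmonicOnNhd V univ := harmonicOnNhd_of_laplacian_eq_zero hV2 hΔ
  have hVc : ∀ y, V y = V 0 := fun y => isConst_of_harmonic_bounded_inner hharm ⟨M, hM⟩ y 0
  rw [show V = fun _ => V 0 from funext hVc]
  exact curl_fun_const _ _

/-! ### A flat inhabitant's vorticity is never spatially constant -/

/-- **Positive palinstrophy somewhere.**  For a flat inhabitant and every `t < 0` there is a point
where `|∇ω(t)|²_F > 0`: otherwise `∇(curl v(t)) ≡ 0`, so `curl v(t) ≡ 0` by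
`curl_eq_zero_of_fderiv_curl_eq_zero` (the slice is smooth, divergence-free and bounded by the
Type-I bound `C/√(−t)`), whence `H(t) = 0`, contradicting the flat law `H(t) = A(−t)^{−2} > 0`. [folklore] -/
theorem exists_frobeniusNormSq_fderiv_curl_pos_of_isFlatInhabitant {ν C A : ℝ} {C' : ℕ → ℝ}
    {v : ℝ → EuclideanSpace ℝ (Fin 3) → EuclideanSpace ℝ (Fin 3)}
    {q : ℝ → EuclideanSpace ℝ (Fin 3) → ℝ} {K : ℝ → EuclideanSpace ℝ (Fin 3) → ℝ}
    (h : IsFlatInhabitant ν C A C' v q K) {t : ℝ} (ht : t < 0) :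
    ∃ x, 0 < frobeniusNormSq (fderiv ℝ (curl (v t)) x) := by
  by_contra hcon
  push Not at hcon
  have hNS : IsClassicalNSSolutionOn (Iio 0) ν 0 v q := h.2.1
  have hTI : HasTypeITimeDecay C v := h.2.2.1
  have hA : 0 < A := h.2.2.2.2.2.2.1
  have hflat : adaptedEnstrophy v K t = A * (-t) ^ (-(2 : ℝ)) := h.2.2.2.2.2.2.2.1 t ht
  have ht' : t ∈ Iio (0 : ℝ) := ht
  have hV : ContDiff ℝ ∞ (v t) := hNS.smooth_velocity.contDiff_slice ht'
  have h0 : ∀ x, fderiv ℝ (curl (v t)) x = 0 := fun x =>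
    eq_zero_of_frobeniusNormSq_eq_zero _ (le_antisymm (hcon x) (frobeniusNormSq_nonneg _))
  have hcurl0 : ∀ x, curl (v t) x = 0 :=
    curl_eq_zero_of_fderiv_curl_eq_zero hV (hNS.divFree t ht') (fun x => hTI t ht x) h0
  have hH0 : adaptedEnstrophy v K t = 0 := by
    rw [adaptedEnstrophy_apply]
    simp [hcurl0]
  have hpos : 0 < A * (-t) ^ (-(2 : ℝ)) := mul_pos hA (Real.rpow_pos_of_pos (by linarith) _)
  rw [← hflat, hH0] at hpos
  exact lt_irrefl _ hpos

/-! ### Continuity and integrability of the budget's three densities -/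

section Densities

variable {ν C A : ℝ} {C' : ℕ → ℝ} {v : ℝ → EuclideanSpace ℝ (Fin 3) → EuclideanSpace ℝ (Fin 3)}
  {q : ℝ → EuclideanSpace ℝ (Fin 3) → ℝ} {K : ℝ → EuclideanSpace ℝ (Fin 3) → ℝ}

/-- The kernel slice of a flat inhabitant is continuous. [folklore] -/
theorem continuous_kernel_slice_of_isFlatInhabitant (h : IsFlatInhabitant ν C A C' v q K) {t : ℝ}
    (ht : t < 0) : Continuous (K t) :=
  (h.2.2.2.2.1.contDiff_slice (show t ∈ Iio (0 : ℝ) from ht)).continuous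

/-- The vorticity slice of a flat inhabitant is `C²`. [folklore] -/
theorem contDiff_two_curl_slice_of_isFlatInhabitant (h : IsFlatInhabitant ν C A C' v q K) {t : ℝ}
    (ht : t < 0) : ContDiff ℝ 2 (curl (v t)) := by
  have hV : ContDiff ℝ ∞ (v t) := h.2.1.smooth_velocity.contDiff_slice (show t ∈ Iio (0 : ℝ) from ht)
  have hV3 : ContDiff ℝ 3 (v t) := hV.of_le (by norm_cast)
  rw [curl_eq_curlCLM_comp]
  exact curlCLM.contDiff.comp (hV3.fderiv_right (m := 2) (by norm_num))

/-- The stretching density `⟪ω, Dv ω⟫` of a flat inhabitant is continuous in `x`. [folklore] -/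
theorem continuous_stretching_of_isFlatInhabitant (h : IsFlatInhabitant ν C A C' v q K) {t : ℝ}
    (ht : t < 0) :
    Continuous fun x => ⟪curl (v t) x, fderiv ℝ (v t) x (curl (v t) x)⟫ := by
  have hV : ContDiff ℝ ∞ (v t) := h.2.1.smooth_velocity.contDiff_slice (show t ∈ Iio (0 : ℝ) from ht)
  have hV2 : ContDiff ℝ 2 (v t) := hV.of_le (by norm_cast)
  have hω : Continuous (curl (v t)) := (contDiff_two_curl_slice_of_isFlatInhabitant h ht).continuous
  have hD : Continuous (fderiv ℝ (v t)) := hV2.continuous_fderiv (by norm_num)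
  exact hω.inner (hD.clm_apply hω)

/-- The palinstrophy density `|∇ω|²_F` of a flat inhabitant is continuous in `x`. [folklore] -/
theorem continuous_palinstrophy_of_isFlatInhabitant (h : IsFlatInhabitant ν C A C' v q K) {t : ℝ}
    (ht : t < 0) : Continuous fun x => frobeniusNormSq (fderiv ℝ (curl (v t)) x) :=
  continuous_frobeniusNormSq'.comp
    ((contDiff_two_curl_slice_of_isFlatInhabitant h ht).continuous_fderiv (by norm_num))

/-- The stretching density against the kernel is integrable (dominated by `C'₁(−t)⁻¹ ‖ω‖² K`). [folklore] -/
theorem integrable_stretching_mul_of_isFlatInhabitant (h : IsFlatInhabitant ν C A C' v q K)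
    {t : ℝ} (ht : t < 0) :
    Integrable fun x => ⟪curl (v t) x, fderiv ℝ (v t) x (curl (v t) x)⟫ * K t x := by
  have hK : IsAdaptedBackwardKernel ν v (Iio 0) 0 0 K := h.2.2.2.2.1
  have hB : ScaleInvariantBounds C' v := h.2.2.2.1
  have ht' : t ∈ Iio (0 : ℝ) := ht
  set L : ℝ := C' 1 * (-t) ^ (-(((1 : ℕ) : ℝ) + 1) / 2) with hL
  have hDv : ∀ x, ‖fderiv ℝ (v t) x‖ ≤ L := fun x => by
    have h1 := hB 1 le_rfl t ht x
    rwa [norm_iteratedFDeriv_one] at h1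
  refine Integrable.mono' ((integrable_normCurlSq_mul_of_isFlatInhabitant h ht).const_mul L)
    (((continuous_stretching_of_isFlatInhabitant h ht).mul
      (continuous_kernel_slice_of_isFlatInhabitant h ht)).aestronglyMeasurable)
    (Eventually.of_forall fun x => ?_)
  have hKx : 0 ≤ K t x := (hK.pos t ht' x).le
  set w := curl (v t) x with hw
  have hin : |⟪w, fderiv ℝ (v t) x w⟫| ≤ L * ‖w‖ ^ 2 := by
    calc |⟪w, fderiv ℝ (v t) x w⟫| ≤ ‖w‖ * ‖fderiv ℝ (v t) x w‖ := abs_real_inner_le_norm _ _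
      _ ≤ ‖w‖ * (‖fderiv ℝ (v t) x‖ * ‖w‖) :=
          mul_le_mul_of_nonneg_left (ContinuousLinearMap.le_opNorm _ _) (norm_nonneg _)
      _ ≤ ‖w‖ * (L * ‖w‖) :=
          mul_le_mul_of_nonneg_left (mul_le_mul_of_nonneg_right (hDv x) (norm_nonneg _))
            (norm_nonneg _)
      _ = L * ‖w‖ ^ 2 := by ring
  rw [Real.norm_eq_abs, abs_mul, abs_of_nonneg hKx]
  calc |⟪w, fderiv ℝ (v t) x w⟫| * K t x ≤ L * ‖w‖ ^ 2 * K t x :=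
        mul_le_mul_of_nonneg_right hin hKx
    _ = L * (‖w‖ ^ 2 * K t x) := by ring

/-- The palinstrophy density against the kernel is integrable (it is a combination of the
stretching term and the first-variation density, both integrable). [folklore] -/
theorem integrable_palinstrophy_mul_of_isFlatInhabitant (h : IsFlatInhabitant ν C A C' v q K)
    {t : ℝ} (ht : t < 0) :
    Integrable fun x => frobeniusNormSq (fderiv ℝ (curl (v t)) x) * K t x := by
  have hν : 0 < ν := h.1
  have h1 := integrable_stretching_mul_of_isFlatInhabitant h ht
  have h2 := integrable_firstVariationDensity_mul_of_isFlatInhabitant h ht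
  have h3 : Integrable fun x =>
      (2 * ν)⁻¹ * (2 * (⟪curl (v t) x, fderiv ℝ (v t) x (curl (v t) x)⟫ * K t x)
        - firstVariationDensity ν v t x * K t x) :=
    ((h1.const_mul 2).sub h2).const_mul _
  refine h3.congr (Eventually.of_forall fun x => ?_)
  simp only [firstVariationDensity]
  field_simp
  ring

end Densities

/-! ### The balance, positivity of the palinstrophy, the strict floor -/

/-- **Palinstrophy balance.**  For a flat inhabitant, at every `t < 0`,
`ν ∫ |∇ω|²_F K = ∫ ⟪ω, Dv ω⟫ K − A(−t)^{−3}` (the instantaneous budget with every term finite). [folklore] -/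
theorem palinstrophy_balance_of_isFlatInhabitant {ν C A : ℝ} {C' : ℕ → ℝ}
    {v : ℝ → EuclideanSpace ℝ (Fin 3) → EuclideanSpace ℝ (Fin 3)}
    {q : ℝ → EuclideanSpace ℝ (Fin 3) → ℝ} {K : ℝ → EuclideanSpace ℝ (Fin 3) → ℝ}
    (h : IsFlatInhabitant ν C A C' v q K) {t : ℝ} (ht : t < 0) :
    ν * ∫ x, frobeniusNormSq (fderiv ℝ (curl (v t)) x) * K t x =
      (∫ x, ⟪curl (v t) x, fderiv ℝ (v t) x (curl (v t) x)⟫ * K t x) - A * (-t) ^ (-(3 : ℝ)) := by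
  have hI := integral_firstVariationDensity_eq_of_isFlatInhabitant h ht
  have h1 := integrable_stretching_mul_of_isFlatInhabitant h ht
  have h3 := integrable_palinstrophy_mul_of_isFlatInhabitant h ht
  have hsplit : (∫ x, firstVariationDensity ν v t x * K t x) =
      2 * (∫ x, ⟪curl (v t) x, fderiv ℝ (v t) x (curl (v t) x)⟫ * K t x)
        - 2 * ν * ∫ x, frobeniusNormSq (fderiv ℝ (curl (v t)) x) * K t x := by
    have e : (fun x => firstVariationDensity ν v t x * K t x) = fun x =>
        2 * (⟪curl (v t) x, fderiv ℝ (v t) x (curl (v t) x)⟫ * K t x)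
          - 2 * ν * (frobeniusNormSq (fderiv ℝ (curl (v t)) x) * K t x) := by
      funext x
      simp only [firstVariationDensity]
      ring
    rw [e, integral_sub (h1.const_mul 2) (h3.const_mul (2 * ν)), integral_const_mul,
      integral_const_mul]
  rw [hsplit] at hI
  linarith

/-- **Positive kernel-weighted palinstrophy**: `∫ |∇ω|²_F K(t) > 0` at every `t < 0` (the density is
continuous, non-negative, positive somewhere, and the kernel is positive). [folklore] -/
theorem integral_palinstrophy_pos_of_isFlatInhabitant {ν C A : ℝ} {C' : ℕ → ℝ}
    {v : ℝ → EuclideanSpace ℝ (Fin 3) → EuclideanSpace ℝ (Fin 3)}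
    {q : ℝ → EuclideanSpace ℝ (Fin 3) → ℝ} {K : ℝ → EuclideanSpace ℝ (Fin 3) → ℝ}
    (h : IsFlatInhabitant ν C A C' v q K) {t : ℝ} (ht : t < 0) :
    0 < ∫ x, frobeniusNormSq (fderiv ℝ (curl (v t)) x) * K t x := by
  have hK : IsAdaptedBackwardKernel ν v (Iio 0) 0 0 K := h.2.2.2.2.1
  have ht' : t ∈ Iio (0 : ℝ) := ht
  set F : EuclideanSpace ℝ (Fin 3) → ℝ := fun x => frobeniusNormSq (fderiv ℝ (curl (v t)) x) * K t x
    with hF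
  have hF0 : 0 ≤ F := fun x => mul_nonneg (frobeniusNormSq_nonneg _) (hK.pos t ht' x).le
  have hFc : Continuous F :=
    (continuous_palinstrophy_of_isFlatInhabitant h ht).mul (continuous_kernel_slice_of_isFlatInhabitant h ht)
  obtain ⟨x₀, hx₀⟩ := exists_frobeniusNormSq_fderiv_curl_pos_of_isFlatInhabitant h ht
  have hFx₀ : F x₀ ≠ 0 := (mul_pos hx₀ (hK.pos t ht' x₀)).ne'
  have hopen : IsOpen (Function.support F) := isOpen_ne_fun hFc continuous_const
  have hμ : 0 < volume (Function.support F) := hopen.measure_pos volume ⟨x₀, hFx₀⟩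
  exact (integral_pos_iff_support_of_nonneg hF0 (integrable_palinstrophy_mul_of_isFlatInhabitant h ht)).2 hμ

/-- **Registered sub-goal `stub_flatEnstrophyLiouville_strictStrainFloor` of Stub 3 of line
`two-ended-pinning` — THE STRICT FLOOR.**  If `(ν, C, A, C', v, q, K)` is a flat inhabitant and at
some `t < 0` the stretching rate in the vorticity direction is bounded by `M`,
`⟪ω, Dv ω⟫ ≤ M‖ω‖²` on `ℝ³`, then `M > 1/(−t)` STRICTLY: by the balance,
`0 < ν∫|∇ω|²_F K = ∫⟪ω, Dv ω⟫K − A(−t)^{−3} ≤ M·A(−t)^{−2} − A(−t)^{−3}`. [folklore] -/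
theorem stub_flatEnstrophyLiouville_strictStrainFloor :
    ∀ (ν C A : ℝ) (C' : ℕ → ℝ) (v : ℝ → EuclideanSpace ℝ (Fin 3) → EuclideanSpace ℝ (Fin 3))
      (q : ℝ → EuclideanSpace ℝ (Fin 3) → ℝ) (K : ℝ → EuclideanSpace ℝ (Fin 3) → ℝ),
      Summit.NavierStokesRegularity.NavierStokesRegularity.Theorems.FrequencyRigidity.Negative.TwoEndedPinning.IsFlatInhabitant
          ν C A C' v q K →
        ∀ t : ℝ, t < 0 → ∀ M : ℝ,
          (∀ x : EuclideanSpace ℝ (Fin 3),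
              inner ℝ (Literature.Analysis.FluidPDE.curl (v t) x)
                  (fderiv ℝ (v t) x (Literature.Analysis.FluidPDE.curl (v t) x)) ≤
                M * ‖Literature.Analysis.FluidPDE.curl (v t) x‖ ^ 2) →
          (-t)⁻¹ < M := by
  intro ν C A C' v q K h t ht M hM
  have hν : 0 < ν := h.1
  have hK : IsAdaptedBackwardKernel ν v (Iio 0) 0 0 K := h.2.2.2.2.1
  have hA : 0 < A := h.2.2.2.2.2.2.1
  have hflat : adaptedEnstrophy v K t = A * (-t) ^ (-(2 : ℝ)) := h.2.2.2.2.2.2.2.1 t ht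
  have hnt : 0 < -t := by linarith
  have ht' : t ∈ Iio (0 : ℝ) := ht
  have hbal := palinstrophy_balance_of_isFlatInhabitant h ht
  have hP := integral_palinstrophy_pos_of_isFlatInhabitant h ht
  have h1 := integrable_stretching_mul_of_isFlatInhabitant h ht
  have h2 : Integrable fun x => M * (‖curl (v t) x‖ ^ 2 * K t x) :=
    (integrable_normCurlSq_mul_of_isFlatInhabitant h ht).const_mul M
  -- ∫⟪ω, Dvω⟫K ≤ M·A(−t)^{−2}
  have hS : (∫ x, ⟪curl (v t) x, fderiv ℝ (v t) x (curl (v t) x)⟫ * K t x) ≤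
      M * (A * (-t) ^ (-(2 : ℝ))) := by
    calc (∫ x, ⟪curl (v t) x, fderiv ℝ (v t) x (curl (v t) x)⟫ * K t x)
        ≤ ∫ x, M * (‖curl (v t) x‖ ^ 2 * K t x) :=
          integral_mono h1 h2 fun x => by
            have hKx : 0 ≤ K t x := (hK.pos t ht' x).le
            calc ⟪curl (v t) x, fderiv ℝ (v t) x (curl (v t) x)⟫ * K t x
                ≤ M * ‖curl (v t) x‖ ^ 2 * K t x := mul_le_mul_of_nonneg_right (hM x) hKx
              _ = M * (‖curl (v t) x‖ ^ 2 * K t x) := by ring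
      _ = M * ∫ x, ‖curl (v t) x‖ ^ 2 * K t x := integral_const_mul _ _
      _ = M * (A * (-t) ^ (-(2 : ℝ))) := by rw [← adaptedEnstrophy_apply, hflat]
  -- hence A(−t)^{−3} < M·A(−t)^{−2}
  have hlt : A * (-t) ^ (-(3 : ℝ)) < M * (A * (-t) ^ (-(2 : ℝ))) := by
    have hνP : 0 < ν * ∫ x, frobeniusNormSq (fderiv ℝ (curl (v t)) x) * K t x := mul_pos hν hP
    linarith
  have e3 : (-t) ^ (-(3 : ℝ)) = (-t) ^ (-(2 : ℝ)) * (-t)⁻¹ := by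
    rw [← Real.rpow_neg_one, ← Real.rpow_add hnt]
    norm_num
  have hc : 0 < A * (-t) ^ (-(2 : ℝ)) := mul_pos hA (Real.rpow_pos_of_pos hnt _)
  have hmul : A * (-t) ^ (-(2 : ℝ)) * (-t)⁻¹ < A * (-t) ^ (-(2 : ℝ)) * M := by
    calc A * (-t) ^ (-(2 : ℝ)) * (-t)⁻¹ = A * (-t) ^ (-(3 : ℝ)) := by rw [e3]; ring
      _ < M * (A * (-t) ^ (-(2 : ℝ))) := hlt
      _ = A * (-t) ^ (-(2 : ℝ)) * M := by ring
  exact lt_of_mul_lt_mul_left hmul hc.le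

/-- **`sup_x ‖Dv(t,x)‖ > 1/(−t)`, strictly**: a uniform gradient bound `M` at some `t < 0` obeys
`M > 1/(−t)`. [folklore] -/
theorem inv_neg_lt_of_norm_fderiv_le_of_isFlatInhabitant {ν C A : ℝ} {C' : ℕ → ℝ}
    {v : ℝ → EuclideanSpace ℝ (Fin 3) → EuclideanSpace ℝ (Fin 3)}
    {q : ℝ → EuclideanSpace ℝ (Fin 3) → ℝ} {K : ℝ → EuclideanSpace ℝ (Fin 3) → ℝ}
    (h : IsFlatInhabitant ν C A C' v q K) {t : ℝ} (ht : t < 0) {M : ℝ}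
    (hM : ∀ x, ‖fderiv ℝ (v t) x‖ ≤ M) : (-t)⁻¹ < M := by
  refine stub_flatEnstrophyLiouville_strictStrainFloor ν C A C' v q K h t ht M fun x => ?_
  set w := curl (v t) x with hw
  calc ⟪w, fderiv ℝ (v t) x w⟫ ≤ ‖w‖ * ‖fderiv ℝ (v t) x w‖ := real_inner_le_norm _ _
    _ ≤ ‖w‖ * (‖fderiv ℝ (v t) x‖ * ‖w‖) :=
        mul_le_mul_of_nonneg_left (ContinuousLinearMap.le_opNorm _ _) (norm_nonneg _)
    _ ≤ ‖w‖ * (M * ‖w‖) :=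
        mul_le_mul_of_nonneg_left (mul_le_mul_of_nonneg_right (hM x) (norm_nonneg _))
          (norm_nonneg _)
    _ = M * ‖w‖ ^ 2 := by ring

/-- **`C'₁ > 1`, strictly**: the first scale-invariant constant of a flat inhabitant exceeds `1`
(the floor at `t = −1` is strict). [folklore] -/
theorem one_lt_scaleInvariantConst_one_of_isFlatInhabitant {ν C A : ℝ} {C' : ℕ → ℝ}
    {v : ℝ → EuclideanSpace ℝ (Fin 3) → EuclideanSpace ℝ (Fin 3)}
    {q : ℝ → EuclideanSpace ℝ (Fin 3) → ℝ} {K : ℝ → EuclideanSpace ℝ (Fin 3) → ℝ}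
    (h : IsFlatInhabitant ν C A C' v q K) : 1 < C' 1 := by
  have hB : ScaleInvariantBounds C' v := h.2.2.2.1
  have hM : ∀ x, ‖fderiv ℝ (v (-1)) x‖ ≤ C' 1 := by
    intro x
    have h1 := hB 1 le_rfl (-1) (by norm_num) x
    rw [norm_iteratedFDeriv_one] at h1
    norm_num at h1
    exact h1
  have := inv_neg_lt_of_norm_fderiv_le_of_isFlatInhabitant h (by norm_num : (-1 : ℝ) < 0) hM
  norm_num at this
  exact this

/-- **No flat inhabitant with `C'₁ ≤ 1`** (sharpening `not_isFlatInhabitant_of_scaleInvariantConst_one_lt_one`). [folklore] -/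
theorem not_isFlatInhabitant_of_scaleInvariantConst_one_le_one {ν C A : ℝ} {C' : ℕ → ℝ}
    {v : ℝ → EuclideanSpace ℝ (Fin 3) → EuclideanSpace ℝ (Fin 3)}
    {q : ℝ → EuclideanSpace ℝ (Fin 3) → ℝ} {K : ℝ → EuclideanSpace ℝ (Fin 3) → ℝ}
    (hC' : C' 1 ≤ 1) : ¬ IsFlatInhabitant ν C A C' v q K :=
  fun h => not_lt.2 hC' (one_lt_scaleInvariantConst_one_of_isFlatInhabitant h)

end Summit.NavierStokesRegularity.NavierStokesRegularity.Theorems.FrequencyRigidity.TwoEndedPinning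

end
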